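import Summits.Ventures.HSemireg.UntwistComplexLeibnizData
import Summits.Ventures.HSemireg.CocycleExtensionCompareDerived
import HarnessLib

/-!
# Venture HSemireg — route R1.0, complex carriers: the LEIBNIZ STEP `At_j(K ⊗ M) = λ•⁻¹ At_j(K)⊗M λ• + ν_j`
# (gs-g4 gen 21, brick C5c of `general-structure/COMPLEX-LEIBNIZ-PLAN-gs-g4.md`)

HONEST FRAMING. Homological algebra on the tree's REAL carriers in the derived category of `𝒪_X`-modules
(`X` an `S`-scheme): the twisted Atiyah step `complexAtiyahStep X j` of th-4/gs-g4's `ComplexAtiyahClass`, the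
termwise cocycle twist `cocycleTwistComplex c K = K ⊗ M`, and the extension-comparison lemma
(`CocycleExtensionCompareDerived`) fed with the jet data of `UntwistComplexLeibnizData`. Nothing about any variety;
nothing here says HC, HC_CM or HC_AV is proved.

## Statements (everything proved)

* `nuStep c j K : Q((K ⊗ M) ⊗ Ωʲ) → Q((K ⊗ M) ⊗ Ωʲ⁺¹)⟦1⟧` — the connecting morphism `ν_j` of the `dlog`-wedge cocycle
  extension of complexes (the class "`1 ⊗ [dlog c]`").
* **`complexAtiyahStep_cocycleTwist`**: `At_j(K ⊗ M) = δ(S₁) + ν_j`, `S₁` the `M`-twist of the `Ωʲ`-twisted Atiyah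
  sequence of `K` with its ends moved by `λ•` (`leibnizS₁`).
* `lamC_triangleOfSESδ_leibnizS₁`: `Q(λ•_j) ≫ δ(S₁) = δ((S_j K) ⊗ M) ≫ Q(λ•_{j+1})⟦1⟧`, and the solved form
  **`complexAtiyahStep_cocycleTwist'`**:
  `At_j(K ⊗ M) = Q(λ•_j)⁻¹ ≫ δ((S_j K) ⊗ M) ≫ Q(λ•_{j+1})⟦1⟧ + ν_j`, where `δ((S_j K) ⊗ M)` is the image of `At_j(K)`
  under `D(- ⊗ M)` by Mathlib's `DerivedCategory.map_triangleOfSESδ`.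

## References

* [Ati57] M. F. Atiyah, *Complex analytic connections in fibre bundles*, Trans. AMS 85 (1957), Prop. 10–12.
* [BF03] R.-O. Buchweitz, H. Flenner, *A semiregularity map for modules and applications to deformations*,
  Compositio Math. 137 (2003), §3.
-/

noncomputable section

set_option backward.isDefEq.respectTransparency false

open CategoryTheory CategoryTheory.Limits AlgebraicGeometry Opposite TopologicalSpace

namespace Summit.Ventures.HSemireg

namespace CocycleTwist

open Literature.AlgebraicGeometry.Modules Literature.AlgebraicGeometry.Motives
  Literature.AlgebraicGeometry.HodgeTheory

universe w' u

variable {S : Type u} [CommRing S] {X : Over (Spec (CommRingCat.of S))} (c : UnitCocycle X.left) (j : ℕ)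
  [HasDerivedCategory.{w'} X.left.Modules] (K : CochainComplex X.left.Modules ℤ)

/-- **`ν_j(K)`**: the connecting morphism of the `dlog`-wedge cocycle extension
`0 → (K ⊗ M) ⊗ Ωʲ⁺¹ → extC w → (K ⊗ M) ⊗ Ωʲ → 0` of complexes — the summand "`1 ⊗ [dlog c]`" of the Leibniz rule.
[cite: Atiyah1957, Prop. 12] -/
def nuStep :
    DerivedCategory.Q.obj (twistHodgeComplex X j (cocycleTwistComplex c K)) ⟶
      (DerivedCategory.Q.obj (twistHodgeComplex X (j + 1) (cocycleTwistComplex c K)))⟦(1 : ℤ)⟧ :=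
  DerivedCategory.triangleOfSESδ (CocycleExtension.shortExactC (dlogWedgeCocycleC c j (cocycleTwistComplex c K)))

/-- **LEIBNIZ STEP for complexes**: `At_j(K ⊗ M) = δ(S₁) + ν_j(K)`, `S₁ =` the `M`-twisted `Ωʲ`-Atiyah sequence of
`K` with `λ•`-moved ends (extension-comparison lemma with `φ_x = t_x⁻¹ ≫ J^j_x`). [cite: Atiyah1957, Prop. 10 and 12] -/
theorem complexAtiyahStep_cocycleTwist :
    complexAtiyahStep X j (cocycleTwistComplex c K) =
      DerivedCategory.triangleOfSESδ (leibnizS₁_shortExact c j K) + nuStep c j K :=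
  ExtensionCompare.triangleOfSESδ_eq_add (leibnizι c j K) (leibnizπ c j K)
    (twistJetComplexShortComplex X j (cocycleTwistComplex c K)).f
    (twistJetComplexShortComplex X j (cocycleTwistComplex c K)).g
    (dlogWedgeCocycleC c j (cocycleTwistComplex c K)) (fun i x => jetCompare c (K.X i) j x)
    (leibniz_hφ c j K) (leibniz_hφd c j K) (leibnizι_π c j K)
    (twistJetComplexShortComplex X j (cocycleTwistComplex c K)).zero (leibnizS₁_shortExact c j K)
    (twistJetComplexShortComplex_shortExact (X := X) j (cocycleTwistComplex c K)) (leibniz_hφι c j K) (leibniz_hφπ c j K)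

omit [HasDerivedCategory.{w'} X.left.Modules] in
/-- The `M`-twist of the `Ωʲ`-Atiyah sequence of `K` is short exact (`- ⊗ M` is exact). [folklore] -/
theorem map_cocycleTwist_shortExact :
    ((twistJetComplexShortComplex X j K).map
      ((twistEquivalence X.left c).functor.mapHomologicalComplex (ComplexShape.up ℤ))).ShortExact :=
  (twistJetComplexShortComplex_shortExact (X := X) j K).map_of_exact
    ((twistEquivalence X.left c).functor.mapHomologicalComplex (ComplexShape.up ℤ))

/-- **`Q(λ•_j) ≫ δ(S₁) = δ((S_j K) ⊗ M) ≫ Q(λ•_{j+1})⟦1⟧`** (naturality of the connecting morphism along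
`leibnizS₁Hom = (λ•_{j+1}, 𝟙, λ•_j)`). [folklore] -/
theorem lamC_triangleOfSESδ_leibnizS₁ :
    DerivedCategory.Q.map (lamC c j K) ≫ DerivedCategory.triangleOfSESδ (leibnizS₁_shortExact c j K) =
      DerivedCategory.triangleOfSESδ (map_cocycleTwist_shortExact c j K) ≫
        (DerivedCategory.Q.map (lamC c (j + 1) K))⟦(1 : ℤ)⟧' :=
  (DerivedCategory.triangleOfSESδ_naturality (map_cocycleTwist_shortExact c j K) (leibnizS₁_shortExact c j K)
    (leibnizS₁Hom c j K)).symm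

/-- **LEIBNIZ STEP, solved form**: `At_j(K ⊗ M) = Q(λ•_j)⁻¹ ≫ δ((S_j K) ⊗ M) ≫ Q(λ•_{j+1})⟦1⟧ + ν_j(K)`; here
`δ((S_j K) ⊗ M)` is `D(- ⊗ M)` applied to `At_j(K)` up to the canonical isomorphisms
(Mathlib `DerivedCategory.map_triangleOfSESδ`). [cite: Atiyah1957, Prop. 10 and 12; BuchweitzFlenner2003, §3] -/
theorem complexAtiyahStep_cocycleTwist' :
    complexAtiyahStep X j (cocycleTwistComplex c K) =
      inv (DerivedCategory.Q.map (lamC c j K)) ≫ DerivedCategory.triangleOfSESδ (map_cocycleTwist_shortExact c j K) ≫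
          (DerivedCategory.Q.map (lamC c (j + 1) K))⟦(1 : ℤ)⟧' +
        nuStep c j K := by
  rw [complexAtiyahStep_cocycleTwist, ← lamC_triangleOfSESδ_leibnizS₁, IsIso.inv_hom_id_assoc]

end CocycleTwist

end Summit.Ventures.HSemireg

end
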